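import Literature.Probability.MarkovChains.BottleneckRatio
import Literature.Probability.MarkovChains.MixingTimeSubmultiplicative
import Literature.Probability.MarkovChains.CoarseRicciCurvature

/-!
HONEST FRAMING: exact (Metropolis-corrected) sampling algorithms for lattice gauge theory; figures
of merit are autocorrelation/cost numbers at stated couplings and volumes; no continuum-physics
claim.

# SkipFreeCountFloor — A COUNT THAT DROPS BY AT MOST ONE PER STEP, AT RATE AT MOST `λ` PER UNIT, IS EXTINCT AT TIME `n` WITH PROBABILITY
# AT MOST `(1+λ)ⁿ/(V_0+1)`; HENCE `d(n) ≥ 1 − (1+λ)ⁿ/(V(x)+1) − π(V ≥ 1)` AND `t_mix(ε) ≥ log((V(x)+1)(1−ε−δ))/λ` — THE COUPON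
# COLLECTOR'S LOGARITHM WITHOUT SECOND MOMENTS (lean-2 GEN-29, ours)

Venture-side (OURS).  Cell `lqcd-flow` (pub-lqcd), unit `pub-lqcd-lean-2-g29`, 2026-08-28.  Chapter O (the floor sees the map quality), file 6:
the generic tool for the `log K` floors.  `Scaling/UnitSurvivalKLogK` (GEN-27) extracted the coupon collector's `log K` for the idealised star from
the first two moments of a survival potential (Paley–Zygmund).  Here a first-step recursion does it with no moments: if `V : X → ℕ` can drop by
at most one in a transition and drops with probability at most `λ·V(x)` from `x`, then `sup_{V(x)=v} P_x{V(X_{n+1}) = 0} ≤ (1−δ_x)·F_v(n) + δ_x·F_{v−1}(n)`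
with `δ_x ≤ λv`, and `F_v(n) = (1+λ)ⁿ/(v+1)` solves the recursion with equality because `1/(v+1) + λv·(1/v − 1/(v+1)) = (1+λ)/(v+1)` — the
telescoping product `Π_j (1 + 1/j) = K+1` of the Chernoff bound for a sum of independent geometric times with rates `λ, 2λ, …, Kλ`.

## What is proved

* `lawAt_single_succ_apply` — first-step decomposition `P^{n+1}(x,y) = Σ_z P(x,z)·Pⁿ(z,y)` for `lawAt` (the row identity `δ_xP = P(x,·)` is the tree's `stepLaw_single_eq_row`).
* **`skipFree_extinction_le`** — `P` row-stochastic, `V : X → ℕ` with `P(x,y) ≠ 0 → V(x) ≤ V(y) + 1` and `Σ_{y : V(y) < V(x)} P(x,y) ≤ λ·V(x)`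
  (`λ ≥ 0`): **`P_x{V(X_n) = 0} ≤ (1+λ)ⁿ/(V(x)+1)`** for every `x`, `n`.
* **`skipFree_worstTvDist_ge`** — with a probability vector `π` giving `{V ≥ 1}` mass `≤ δ`: **`d(n) ≥ 1 − (1+λ)ⁿ/(V(x)+1) − δ`**.
* **`skipFree_mixingTime_ge`** — `λ > 0`, `ε + δ < 1`, the chain `ε`-close to `π` at some time: **`log((V(x)+1)·(1−ε−δ))/λ ≤ t_mix(ε)`**.

Reading (no numerics implied): planting `K` rare labels that can only be destroyed one at a time, each at rate `≤ λ`, forces `(log K)/λ` steps before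
the chain can look like its equilibrium — whatever creates, moves or re-creates labels otherwise.  Used next for the map-assisted hub with the label
"replica `k` holds a configuration of the starved sector" (`λ = t·ĉ·p'·q'/m`).  NOT CLAIMED: anything measured.  Literature grade (cell rule): OWN
LEMMA (first-step recursion; the telescoping Chernoff product); nothing cited as a fact; no new bib keys.
-/

noncomputable section

open Finset Function
open Literature.Probability.MarkovChains

namespace Summit.Ventures.LatticeQCDFlow.Scaling

variable {X : Type*} [Fintype X] [DecidableEq X]

/-! ## §1 First-step decomposition -/

/-- **First-step decomposition:** `P^{n+1}(x,y) = Σ_z P(x,z)·Pⁿ(z,y)`. [folklore] -/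
theorem lawAt_single_succ_apply (P : X → X → ℝ) (x y : X) (n : ℕ) :
    lawAt P (Pi.single x 1) (n + 1) y = ∑ z, P x z * lawAt P (Pi.single z 1) n y := by
  rw [show n + 1 = 1 + n by ring, lawAt_add, show lawAt P (Pi.single x 1) 1 = stepLaw P (Pi.single x 1) by
    rw [lawAt_succ, lawAt_zero], stepLaw_single_eq_row, lawAt_eq_sum_mul_lawAt_single]

/-! ## §2 The extinction bound -/

/-- **THE SKIP-FREE COUNT BOUND:** `P` row-stochastic, `V : X → ℕ` dropping by at most one along every transition and with total drop
probability `Σ_{y : V(y) < V(x)} P(x,y) ≤ λ·V(x)` (`λ ≥ 0`): **`P_x{V(X_n) = 0} ≤ (1+λ)ⁿ/(V(x)+1)`**. [ours] -/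
theorem skipFree_extinction_le {P : X → X → ℝ} (hP : IsRowStochastic P) (V : X → ℕ)
    (hskip : ∀ x y, P x y ≠ 0 → V x ≤ V y + 1) {lam : ℝ} (hlam : 0 ≤ lam)
    (hdrop : ∀ x, ∑ y ∈ univ.filter (fun y => V y < V x), P x y ≤ lam * V x) :
    ∀ (n : ℕ) (x : X), ∑ y ∈ univ.filter (fun y => V y = 0), lawAt P (Pi.single x 1) n y ≤ (1 + lam) ^ n / ((V x : ℝ) + 1) := by
  intro n
  induction n with
  | zero =>
    intro x
    rw [pow_zero, lawAt_zero]
    by_cases hx : V x = 0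
    · rw [Finset.sum_eq_single_of_mem x (mem_filter.mpr ⟨mem_univ _, hx⟩) (fun z _ hz => Pi.single_eq_of_ne hz _),
        Pi.single_eq_same, hx, Nat.cast_zero, zero_add, div_one]
    · have h0 : ∑ y ∈ univ.filter (fun y => V y = 0), (Pi.single x (1 : ℝ) : X → ℝ) y = 0 := by
        refine Finset.sum_eq_zero fun z hz => ?_
        have hz' := (mem_filter.mp hz).2
        have hzx : z ≠ x := fun h => hx (by rw [← h]; exact hz')
        exact Pi.single_eq_of_ne hzx _
      rw [h0]
      positivity
  | succ n ih =>
    intro x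
    have hVx0 : (0 : ℝ) < (V x : ℝ) + 1 := by positivity
    -- first step, then the induction hypothesis at each successor
    have hstep : ∑ y ∈ univ.filter (fun y => V y = 0), lawAt P (Pi.single x 1) (n + 1) y
        = ∑ z, P x z * ∑ y ∈ univ.filter (fun y => V y = 0), lawAt P (Pi.single z 1) n y := by
      simp_rw [lawAt_single_succ_apply, Finset.mul_sum]
      rw [Finset.sum_comm]
    rw [hstep]
    -- the per-successor coefficient: `1/V(x)` if the count dropped (then `V z = V x − 1`), else `1/(V(x)+1)`
    have hterm : ∀ z, P x z * ∑ y ∈ univ.filter (fun y => V y = 0), lawAt P (Pi.single z 1) n y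
        ≤ P x z * ((1 + lam) ^ n * (if V z < V x then 1 / (V x : ℝ) else 1 / ((V x : ℝ) + 1))) := by
      intro z
      by_cases hPz : P x z = 0
      · rw [hPz, zero_mul, zero_mul]
      refine mul_le_mul_of_nonneg_left ((ih z).trans ?_) (hP.1 x z)
      rw [div_eq_mul_one_div]
      refine mul_le_mul_of_nonneg_left ?_ (by positivity)
      by_cases hlt : V z < V x
      · have hle := hskip x z hPz
        have hVz : (V z : ℝ) + 1 = V x := by
          have : V z + 1 = V x := by omega
          exact_mod_cast this
        rw [if_pos hlt, hVz]
      · rw [if_neg hlt]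
        have hge : (V x : ℝ) ≤ V z := by exact_mod_cast (not_lt.mp hlt)
        exact one_div_le_one_div_of_le hVx0 (by linarith)
    refine (sum_le_sum fun z _ => hterm z).trans ?_
    have hsplit : ∑ z, P x z * ((1 + lam) ^ n * (if V z < V x then 1 / (V x : ℝ) else 1 / ((V x : ℝ) + 1)))
        = (1 + lam) ^ n * ∑ z, P x z * (if V z < V x then 1 / (V x : ℝ) else 1 / ((V x : ℝ) + 1)) := by
      rw [Finset.mul_sum]; exact sum_congr rfl fun z _ => by ring
    rw [hsplit, pow_succ, mul_div_assoc]
    refine mul_le_mul_of_nonneg_left ?_ (by positivity)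
    -- `Σ_z P(x,z)·c_z = 1/(V+1) + δ·(1/V − 1/(V+1))` with `δ = Σ_{V z < V x} P(x,z) ≤ λ·V`
    have hcz : ∀ z, P x z * (if V z < V x then 1 / (V x : ℝ) else 1 / ((V x : ℝ) + 1))
        = P x z * (1 / ((V x : ℝ) + 1))
          + (if V z < V x then P x z * (1 / (V x : ℝ) - 1 / ((V x : ℝ) + 1)) else 0) := by
      intro z
      by_cases h : V z < V x
      · rw [if_pos h, if_pos h]; ring
      · rw [if_neg h, if_neg h]; ring
    rw [sum_congr rfl fun z _ => hcz z, sum_add_distrib, ← sum_mul, hP.2 x, one_mul, ← Finset.sum_filter, ← sum_mul]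
    by_cases hV0 : V x = 0
    · -- no successors below: the correction vanishes
      have hemp : univ.filter (fun z => V z < V x) = ∅ := by
        rw [Finset.filter_eq_empty_iff]; intro z _; rw [hV0]; exact Nat.not_lt_zero _
      rw [hemp, sum_empty, zero_mul, add_zero, hV0, Nat.cast_zero, zero_add, div_one, div_one]
      linarith
    · have hVpos : (0 : ℝ) < V x := by exact_mod_cast Nat.pos_of_ne_zero hV0
      have hδle : ∑ z ∈ univ.filter (fun z => V z < V x), P x z ≤ lam * V x := hdrop x
      have hdiff : 0 ≤ 1 / (V x : ℝ) - 1 / ((V x : ℝ) + 1) := by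
        rw [sub_nonneg]; exact one_div_le_one_div_of_le hVpos (by linarith)
      calc 1 / ((V x : ℝ) + 1) + (∑ z ∈ univ.filter (fun z => V z < V x), P x z) * (1 / (V x : ℝ) - 1 / ((V x : ℝ) + 1))
          ≤ 1 / ((V x : ℝ) + 1) + lam * V x * (1 / (V x : ℝ) - 1 / ((V x : ℝ) + 1)) := by
            nlinarith [mul_le_mul_of_nonneg_right hδle hdiff]
        _ = (1 + lam) / ((V x : ℝ) + 1) := by
            field_simp
            ring

/-! ## §3 The distance and mixing-time floors -/

/-- **`d(n) ≥ 1 − (1+λ)ⁿ/(V(x)+1) − δ`** whenever the probability vector `π` gives `{V ≥ 1}` mass `≤ δ` (skip-free count as above). [ours] -/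
theorem skipFree_worstTvDist_ge {P : X → X → ℝ} (hP : IsRowStochastic P) (V : X → ℕ)
    (hskip : ∀ x y, P x y ≠ 0 → V x ≤ V y + 1) {lam : ℝ} (hlam : 0 ≤ lam)
    (hdrop : ∀ x, ∑ y ∈ univ.filter (fun y => V y < V x), P x y ≤ lam * V x)
    {π : X → ℝ} (hπ1 : ∑ y, π y = 1) {δ : ℝ} (hδ : ∑ y ∈ univ.filter (fun y => 0 < V y), π y ≤ δ) (x : X) (n : ℕ) :
    1 - (1 + lam) ^ n / ((V x : ℝ) + 1) - δ ≤ worstTvDist P π n := by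
  refine le_trans ?_ (tvDist_single_le_worstTvDist P π n x)
  have hmass : ∑ y, lawAt P (Pi.single x 1) n y = ∑ y, π y := by
    rw [sum_lawAt hP, hπ1]; simp
  have hev := sub_sum_le_tvDist hmass (univ.filter (fun y => 0 < V y))
  -- the law's mass on `{V ≥ 1}` is `1 − (mass on {V = 0}) ≥ 1 − (1+λ)ⁿ/(V x+1)`
  have hcompl : ∑ y ∈ univ.filter (fun y => 0 < V y), lawAt P (Pi.single x 1) n y
      = 1 - ∑ y ∈ univ.filter (fun y => V y = 0), lawAt P (Pi.single x 1) n y := by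
    have h := Finset.sum_filter_add_sum_filter_not univ (fun y => V y = 0) (lawAt P (Pi.single x 1) n)
    rw [sum_lawAt hP] at h
    have e : univ.filter (fun y => ¬V y = 0) = univ.filter (fun y => 0 < V y) := by
      ext y; simp [Nat.pos_iff_ne_zero]
    rw [e] at h
    simp only [Pi.single_apply, Finset.sum_ite_eq', mem_univ, if_true] at h
    linarith
  have hext := skipFree_extinction_le hP V hskip hlam hdrop n x
  linarith

/-- **`t_mix(ε) ≥ log((V(x)+1)·(1−ε−δ))/λ`** (`λ > 0`, `ε + δ < 1`, the chain `ε`-close to `π` at some time; `π` and `δ` as above). [ours] -/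
theorem skipFree_mixingTime_ge {P : X → X → ℝ} (hP : IsRowStochastic P) (V : X → ℕ)
    (hskip : ∀ x y, P x y ≠ 0 → V x ≤ V y + 1) {lam : ℝ} (hlam : 0 < lam)
    (hdrop : ∀ x, ∑ y ∈ univ.filter (fun y => V y < V x), P x y ≤ lam * V x)
    {π : X → ℝ} (hπ1 : ∑ y, π y = 1) {δ : ℝ} (hδ : ∑ y ∈ univ.filter (fun y => 0 < V y), π y ≤ δ) (x : X)
    {ε : ℝ} (hεδ : ε + δ < 1) (hmix : ∃ n, worstTvDist P π n ≤ ε) :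
    Real.log (((V x : ℝ) + 1) * (1 - ε - δ)) / lam ≤ (mixingTime P π ε : ℝ) := by
  obtain ⟨n₀, hn₀⟩ := hmix
  set n := mixingTime P π ε with hn
  have hd : worstTvDist P π n ≤ ε := worstTvDist_mixingTime_le P π hn₀
  have hfloor := skipFree_worstTvDist_ge hP V hskip hlam.le hdrop hπ1 hδ x n
  have hVx0 : (0 : ℝ) < (V x : ℝ) + 1 := by positivity
  have hpos : 0 < ((V x : ℝ) + 1) * (1 - ε - δ) := mul_pos hVx0 (by linarith)
  -- `(V+1)(1−ε−δ) ≤ (1+λ)ⁿ`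
  have hkey : ((V x : ℝ) + 1) * (1 - ε - δ) ≤ (1 + lam) ^ n := by
    have h1 : 1 - ε - δ ≤ (1 + lam) ^ n / ((V x : ℝ) + 1) := by linarith
    have := mul_le_mul_of_nonneg_left h1 hVx0.le
    rwa [mul_div_cancel₀ _ hVx0.ne'] at this
  have hlog : Real.log (((V x : ℝ) + 1) * (1 - ε - δ)) ≤ n * Real.log (1 + lam) := by
    rw [← Real.log_pow]; exact Real.log_le_log hpos hkey
  have hl1 : Real.log (1 + lam) ≤ lam := by
    have := Real.add_one_le_exp lam
    calc Real.log (1 + lam) ≤ Real.log (Real.exp lam) := Real.log_le_log (by linarith) (by linarith)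
      _ = lam := Real.log_exp lam
  rw [div_le_iff₀ hlam]
  calc Real.log (((V x : ℝ) + 1) * (1 - ε - δ)) ≤ n * Real.log (1 + lam) := hlog
    _ ≤ n * lam := mul_le_mul_of_nonneg_left hl1 (Nat.cast_nonneg n)

end Summit.Ventures.LatticeQCDFlow.Scaling

end
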